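import Mathlib
import Literature.AlgebraicGeometry.Resolution.ProjectiveSpaceRegular
import Literature.AlgebraicGeometry.Resolution.AlterationsProofs
import Literature.AlgebraicGeometry.Resolution.ResolutionGlue
import Summits.ResolutionOfSingularities.ResolutionOfSingularities.Theorems.PAlterationPicoverToRadicialBottomAdjoinRootsTensor
import Summits.ResolutionOfSingularities.ResolutionOfSingularities.Theorems.PAlterationPicoverToRadicialBottomRegularLimit

/-!
# `PAlteration.PicoverToRadicialBottom`, line `theta-finite-cofinite-roots`: the cofinite regular twist

Stub `stub_cofiniteRegularTwist` of the line (lead prover-line-stmt-ResolutionOfSingularities-0556-1):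
**for `Z` regular of finite type over a field `k` of characteristic `p` and `r ≥ 0` there is a
field `L ⊇ k` inside `k^{1/p^r}` (`ψ : L → k` with `ψ x = x^{p^r}`, `ψ a = a^{p^r}` for `a ∈ k`),
of finite codegree (`ψ` finite), with `Z ×ₖ Spec L` REGULAR** — given relative `p`-bases
(`stub_relPBasis`). Height one: cover `Z` by finitely many affine opens `Spec A_i`, present
`A_i = k[x]/(G_i)`, let `C` be the finite set of coefficients of the `G_i`, take a `p`-basis `S`
of `k` over `k^p(C)` and `L := k(θ S)` for chosen `p`-th roots `θ` in an algebraic closure; then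
`L ⊗ₖ A_i` is regular (radical tower `adjoinRootsTensor_isRegularRing` and regular limit
`regularLimit_tensor_of_exhaustion`), and these are the affine pieces of `Z ×ₖ Spec L`. All
heights by induction on `r` (twist the regular `Z ×ₖ Spec L_r` over `L_r` once more).
-/

noncomputable section

-- single-problem summit: the doubled namespace component `ResolutionOfSingularities` is forced
set_option linter.dupNamespace false

open Polynomial TensorProduct Literature.FieldTheory.Separability
  Literature.AlgebraicGeometry.Resolution

namespace Summit.ResolutionOfSingularities.ResolutionOfSingularities.Theorems


/-! ## The cofinite regular twist of a regular scheme of finite type (height one) -/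

section SchemeTwist

open CategoryTheory CategoryTheory.Limits AlgebraicGeometry TopologicalSpace

/-- **The cofinite regular twist, `r = 1`.** Given relative `p`-bases, for `Z` regular of finite
type over `k` there is a field `L ⊇ k` inside `k^{1/p}` (`ψ : L → k` with `ψ x = x^p`,
`ψ a = a^p`, `ψ` finite) with `Z ×ₖ Spec L` regular: cover `Z` by finitely many affine opens
`Spec A_i`, present `A_i = k[x]/(G_i)`, let `C` be the (finite) set of coefficients of the `G_i`,
take a `p`-basis `S` of `k` over `k^p(C)` and `L := k(θ S)` for chosen `p`-th roots `θ` in an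
algebraic closure; then `L ⊗ₖ A_i` is regular (`isRegularRing_adjoin_roots_tensor`,
`isRegularRing_adjoin_roots_tensor_of_finite`) and these are the affine pieces of `Z ×ₖ Spec L`.
[folklore] -/
theorem exists_cofiniteRegularTwist_one
    (hPB : ∀ (p : ℕ) [Fact p.Prime] (k : Type) [Field k] [CharP k p] (C : Finset k),
      ∃ S : Set k, pAdjoin p (S ∪ ↑C) = ⊤ ∧ ∀ b ∈ S, b ∉ pAdjoin p (↑C ∪ (S \ {b})))
    (p : ℕ) [Fact p.Prime] (k : Type) [Field k] [CharP k p] (Z : Scheme.{0})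
    (fZ : Z ⟶ Spec (.of k)) [LocallyOfFiniteType fZ] [QuasiCompact fZ] (hZ : Scheme.IsRegular Z) :
    ∃ (L : Type) (_ : Field L) (_ : Algebra k L) (ψ : L →+* k),
      (∀ x : L, algebraMap k L (ψ x) = x ^ p) ∧ (∀ a : k, ψ (algebraMap k L a) = a ^ p) ∧
      ψ.Finite ∧ Scheme.IsRegular (pullback fZ (Spec.map (CommRingCat.ofHom (algebraMap k L)))) := by
  classical
  have hp : p.Prime := Fact.out
  -- `Z` is compact; a finite affine open cover
  haveI : CompactSpace Z := by
    have := QuasiCompact.isCompact_preimage (f := fZ) (U := ⊤) isOpen_univ (by simp)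
    exact ⟨by simpa using this⟩
  let 𝒱 : Z.OpenCover := Z.affineOpenCover.openCover.finiteSubcover
  let R : 𝒱.I₀ → CommRingCat.{0} := fun i =>
    Z.affineOpenCover.X (Z.affineOpenCover.openCover.idx i.1)
  let g : ∀ i, Spec (R i) ⟶ Z := fun i => 𝒱.f i
  haveI hgi : ∀ i, IsOpenImmersion (g i) := fun i => inferInstanceAs (IsOpenImmersion (𝒱.f i))
  -- the `k`-algebra structures on the rings `R i`
  have hsurj : ∀ i, ∃ φ : CommRingCat.of k ⟶ R i, Spec.map φ = g i ≫ fZ := fun i =>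
    Spec.map_surjective (g i ≫ fZ)
  choose φ hφ using hsurj
  letI : ∀ i, Algebra k (R i) := fun i => (φ i).hom.toAlgebra
  have halg : ∀ i, CommRingCat.ofHom (algebraMap k (R i)) = φ i := fun i => rfl
  haveI hft : ∀ i, Algebra.FiniteType k (R i) := fun i => by
    have h1 : LocallyOfFiniteType (Spec.map (φ i)) := by rw [hφ i]; infer_instance
    exact (HasRingHomProperty.Spec_iff (P := @LocallyOfFiniteType)).mp h1
  haveI hnoeth : ∀ i, IsNoetherianRing (R i) := fun i => Algebra.FiniteType.isNoetherianRing k _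
  haveI hreg : ∀ i, IsRegularRing (R i) := fun i =>
    (Scheme.isRegular_Spec_iff (R i)).mp (hZ.of_isOpenImmersion (g i))
  -- presentations and the finite set `C` of coefficients
  have hpres : ∀ i, ∃ (n : ℕ) (π : MvPolynomial (Fin n) k →ₐ[k] R i), Function.Surjective π :=
    fun i => (Algebra.FiniteType.iff_quotient_mvPolynomial'' ).mp (hft i)
  choose n π hπ using hpres
  have hker : ∀ i, ∃ G : Finset (MvPolynomial (Fin (n i)) k), Ideal.span (↑G : Set _) =
      RingHom.ker (π i) := fun i => (inferInstance : IsNoetherianRing _).noetherian _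
  choose G hG using hker
  let C : Finset k := Finset.univ.biUnion fun i => (G i).biUnion fun q => q.support.image q.coeff
  have hC : ∀ i, ∀ q ∈ G i, ∀ m, ∀ δ : Derivation ℤ k k, (∀ c ∈ (↑C : Set k), δ c = 0) →
      δ (q.coeff m) = 0 := by
    intro i q hq m δ hδ
    by_cases hm : m ∈ q.support
    · exact hδ _ (Finset.mem_biUnion.mpr ⟨i, Finset.mem_univ i, Finset.mem_biUnion.mpr
        ⟨q, hq, Finset.mem_image_of_mem _ hm⟩⟩)
    · rw [MvPolynomial.notMem_support_iff.mp hm, map_zero]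
  -- the relative `p`-basis `S` and the root field `L = k(θ S)`
  obtain ⟨S, hSC, hS⟩ := hPB p k C
  let Ω := AlgebraicClosure k
  have hroot : ∀ a : k, ∃ x : Ω, x ^ p = algebraMap k Ω a := fun a =>
    IsAlgClosed.exists_pow_nat_eq _ hp.pos
  choose θ hθ using hroot
  let L := IntermediateField.adjoin k (θ '' S)
  -- `L ⊗ₖ R i` is regular for every `i`
  have hregL : ∀ i, IsRegularRing ((R i) ⊗[k] L) := by
    intro i
    have hA : ∀ δ : Derivation ℤ k k, (∀ c ∈ (↑C : Set k), δ c = 0) →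
        ∃ D : Derivation ℤ (R i) (R i), ∀ a : k, D (algebraMap k (R i) a) = algebraMap k (R i) (δ a) :=
      fun δ hδ => exists_derivation_extends_of_presentation (π i) (hπ i) (↑(G i)) (hG i).symm δ
        (fun q hq m => hC i q hq m δ hδ)
    have hfin := isRegularRing_adjoin_roots_tensor θ hθ (R i) (↑C) S hS hA
    haveI := isRegularRing_adjoin_roots_tensor_of_finite θ hθ S (R i) hfin
    exact IsRegularRing.of_ringEquiv (Algebra.TensorProduct.comm k L (R i)).toRingEquiv
  -- the Frobenius `ψ`
  obtain ⟨ψ, hψ1, hψ2, hψS⟩ := exists_rootField_frobenius θ hθ S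
  have hψfin : ψ.Finite := by
    refine ringHom_finite_of_pAdjoin_eq_top S C hSC ψ (fun a => ⟨algebraMap k L a, hψ2 a⟩)
      fun s hs => ⟨⟨θ s, IntermediateField.subset_adjoin k _ ⟨s, hs, rfl⟩⟩, hψS s _⟩
  refine ⟨L, inferInstance, inferInstance, ψ, hψ1, hψ2, hψfin, ?_⟩
  -- regularity of the base change, on the affine pieces
  set j := Spec.map (CommRingCat.ofHom (algebraMap k L)) with hj
  let 𝒲 := Scheme.Pullback.openCoverOfLeft 𝒱 fZ j
  refine Scheme.IsRegular.of_forall_exists_isOpenImmersion fun x => ?_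
  obtain ⟨y, hy⟩ := 𝒲.covers x
  refine ⟨𝒲.X (𝒲.idx x), 𝒲.f (𝒲.idx x), inferInstance, ⟨y, hy⟩, ?_⟩
  set i := 𝒲.idx x
  -- `𝒲.X i = pullback (g i ≫ fZ) j ≅ Spec (R i ⊗ₖ L)`
  have e1 : pullback (𝒱.f i ≫ fZ) j ≅ pullback (Spec.map (CommRingCat.ofHom (algebraMap k (R i)))) j :=
    pullback.congrHom (by rw [halg, hφ]; rfl) rfl
  let e : pullback (𝒱.f i ≫ fZ) j ≅ Spec (.of ((R i) ⊗[k] L)) := e1 ≪≫ pullbackSpecIso k (R i) L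
  have hSpec : Scheme.IsRegular (Spec (.of ((R i) ⊗[k] L))) := Scheme.isRegular_Spec _
  exact Scheme.IsRegular.of_iso e.inv hSpec

end SchemeTwist


/-! ## All heights: induction on `r` -/

section AllHeights

open CategoryTheory CategoryTheory.Limits AlgebraicGeometry TopologicalSpace

/-- **S2 (cofinite regular twist).** Given relative `p`-bases, for `Z` regular of finite type over
`k` and `r : ℕ` there is a field `L ⊇ k` inside `k^{1/p^r}` (`ψ : L → k` with `ι ∘ ψ = Frob^r`,
`ψ ∘ ι = Frob^r`) of finite codegree (`ψ` finite) with `Z ⊗_k L` regular: induction on `r`, the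
step being the height-one twist `exists_cofiniteRegularTwist_one` of the regular
`Z ×ₖ Spec L_r` over `L_r`. [folklore] -/
theorem stub_cofiniteRegularTwist :
    (∀ (p : ℕ) [Fact p.Prime] (k : Type) [Field k] [CharP k p] (C : Finset k),
      ∃ S : Set k, pAdjoin p (S ∪ ↑C) = ⊤ ∧ ∀ b ∈ S, b ∉ pAdjoin p (↑C ∪ (S \ {b}))) →
    ∀ (p : ℕ) [Fact p.Prime] (k : Type) [Field k] [CharP k p] (Z : Scheme.{0})
    (fZ : Z ⟶ Spec (.of k)) [LocallyOfFiniteType fZ] [QuasiCompact fZ], Scheme.IsRegular Z →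
    ∀ r : ℕ, ∃ (L : Type) (_ : Field L) (_ : Algebra k L) (ψ : L →+* k),
      (∀ x : L, algebraMap k L (ψ x) = x ^ p ^ r) ∧ (∀ a : k, ψ (algebraMap k L a) = a ^ p ^ r) ∧
      ψ.Finite ∧ Scheme.IsRegular (pullback fZ (Spec.map (CommRingCat.ofHom (algebraMap k L)))) := by
  intro hPB p _ k _ _ Z fZ _ _ hZ r
  induction r with
  | zero =>
    -- `L = k`, `ψ = id`
    refine ⟨k, inferInstance, inferInstance, RingHom.id k, fun x => by simp, fun a => by simp,
      RingHom.Finite.id k, ?_⟩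
    have hj : Spec.map (CommRingCat.ofHom (algebraMap k k)) = 𝟙 (Spec (CommRingCat.of k)) := by
      rw [Algebra.algebraMap_self, CommRingCat.ofHom_id]
      exact Spec.map_id _
    haveI : IsIso (Spec.map (CommRingCat.ofHom (algebraMap k k))) := by rw [hj]; infer_instance
    exact hZ.of_isOpenImmersion (pullback.fst fZ (Spec.map (CommRingCat.ofHom (algebraMap k k))))
  | succ r ih =>
    obtain ⟨Lr, _, _, ψr, hψr1, hψr2, hψrfin, hregr⟩ := ih
    haveI : CharP Lr p := charP_of_injective_algebraMap (algebraMap k Lr).injective p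
    set jr := Spec.map (CommRingCat.ofHom (algebraMap k Lr)) with hjr
    -- the height-one twist of `Z_r := Z ×ₖ Spec L_r` over `L_r`
    obtain ⟨L', _, _, ψ', hψ'1, hψ'2, hψ'fin, hreg'⟩ :=
      exists_cofiniteRegularTwist_one hPB p Lr (pullback fZ jr) (pullback.snd fZ jr) hregr
    letI : Algebra k L' := ((algebraMap Lr L').comp (algebraMap k Lr)).toAlgebra
    have halg : ∀ a : k, algebraMap k L' a = algebraMap Lr L' (algebraMap k Lr a) := fun _ => rfl
    refine ⟨L', inferInstance, inferInstance, ψr.comp ψ', fun x => ?_, fun a => ?_,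
      hψrfin.comp hψ'fin, ?_⟩
    · rw [RingHom.comp_apply, halg, hψr1, map_pow, hψ'1, ← pow_mul, ← pow_succ']
    · rw [RingHom.comp_apply, halg, hψ'2, map_pow, hψr2, ← pow_mul, ← pow_succ]
    · -- `Z ×ₖ Spec L' ≅ (Z ×ₖ Spec L_r) ×_{L_r} Spec L'`
      set j' := Spec.map (CommRingCat.ofHom (algebraMap Lr L')) with hj'
      have hcomp : j' ≫ jr = Spec.map (CommRingCat.ofHom (algebraMap k L')) := by
        rw [hj', hjr, ← Spec.map_comp, ← CommRingCat.ofHom_comp]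
      let e : pullback (pullback.snd fZ jr) j' ≅
          pullback fZ (Spec.map (CommRingCat.ofHom (algebraMap k L'))) :=
        pullbackLeftPullbackSndIso fZ jr j' ≪≫ pullback.congrHom rfl hcomp
      exact Scheme.IsRegular.of_iso e.hom hreg'

end AllHeights

end Summit.ResolutionOfSingularities.ResolutionOfSingularities.Theorems

end
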